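import Summits.AtomisticToContinuum.HydrodynamicLimit.Theorems.EnskogAdjointDualityEquilibriumCollisionResidualKernelSymmetry
import HarnessLib

/-!
# The Enskog centring term of `EnskogAdjointDuality` vanishes exactly at global equilibrium (K4 statics II)

Route `EnskogAdjointDuality` of `AtomisticToContinuum/HydrodynamicLimit`, support item
`EquilibriumCollisionResidual` (stmt-AtomisticToContinuum-9169) and the bookkeeping of the crux
`CollisionResidualVanishes` (stmt-AtomisticToContinuum-14658).  The collision residual of the route is
`𝓡_N[φ] = C_N[φ] − ∫₀ᵗ ⟨μ^N_s, L^N_s φ_s⟩ ds + ½ ∫₀ᵗ ∫∫ f_s L^N_s φ_s`, with the test-side linearised Enskog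
operator
`(L^N_s φ)(x, v) = λ_N ∫_{S²} ∫ ((v − w)·ω)₊ Y f_s(x + εω, w) [φ(x, v′) + φ(x + εω, w′) − φ(x, v) − φ(x + εω, w)] dw dσ(ω)`,
`v′ = v − ((v − w)·ω) ω`, `w′ = w + ((v − w)·ω) ω`.  At GLOBAL EQUILIBRIUM (constant profiles:
`f_s(x, v) = M(v) := M_{1,u,θ}(v)`, `Y` constant) the deterministic centring term vanishes identically,
for EVERY test function `φ(x, v)` of quadratic growth in `v` and every `N`:

  `∫_{𝕋³} ∫ M(v) (L φ)(x, v) dv dx = 0`     (`integral_localMaxwellian_mul_enskogTest_eq_zero`),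

and, verbatim in the `let`-vocabulary of the route decl, `∫∫ f_s L^N_s φ^N_s = 0` for every admissible
family (`equilibrium_centringTerm_eq_zero`).  So at equilibrium `𝓡_N = C_N − ∫⟨μ_s, L_s φ_s⟩ ds` exactly
(refuter route-review memo on stmt-9169, made a theorem): kill criterion (a) of the route — a nonzero
deterministic limit of `𝓡_N` at equilibrium — can never be fed by the `½ ∫∫ f Lφ` term.

Proof: for fixed `ω` the bracket identity of the companion file gives
`∫∫ M M ((v−w)·ω)₊ [φ_x(v′) + φ_y(w′) − φ_x(v) − φ_y(w)] = q(y, ω) − q(x, ω)`, `y = x + εω` a translate of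
`x`; after the Fubini exchanges `v ↔ ω` and `x ↔ ω` (Gaussian-moment domination, finiteness of the sphere
measure, compactness of `𝕋³`) the `x`-integral of the difference vanishes by translation invariance of Haar
measure on `𝕋³`.  No property of `Y`, `λ_N`, `ε` or of the normalisation of `M` is used.

References: C. Cercignani, R. Illner, M. Pulvirenti, *The Mathematical Theory of Dilute Gases* (1994),
§3.1 [CIP1994]; H. van Beijeren, M. H. Ernst, Physica 68 (1973) 437–456 (Enskog collision operator)
[VanbeijerenErnst1973].
-/

noncomputable section

open MeasureTheory Metric Set Filter Topology Function
open scoped InnerProductSpace ENNReal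

namespace Summit.AtomisticToContinuum.HydrodynamicLimit.Theorems.EnskogAdjointDuality

open Literature.Analysis.FluidPDE Literature.MathematicalPhysics.KineticTheory

/-! ## Assembly on `𝕋³ × ℝ³`: the centring term vanishes -/

section Torus

/-- Joint continuity of the contact-shift `(x, ω) ↦ x + εω` on `𝕋³ × S²`. [folklore] -/
theorem continuous_torus_translate_sphere (ε : ℝ) :
    Continuous (fun r : T3 × sphere (0 : V3) 1 =>
      (Torus.geometry (Fin 3)).translate r.1 (ε • (r.2 : V3))) := by
  simp only [Torus.geometry_translate]
  refine continuous_fst.add ?_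
  exact Literature.Analysis.FunctionSpaces.Torus.continuous_proj.comp
    ((continuous_subtype_val.comp continuous_snd).const_smul ε)

/-- **The Enskog centring term vanishes at global equilibrium.** For `θ > 0`, a drift `u`, constants
`ε, λ, Y` and a jointly continuous test function `φ : 𝕋³ → ℝ³ → ℝ` of quadratic velocity growth,
`∫_{𝕋³} dx ∫ dv M(v) · λ ∫_{S²} dσ(ω) ∫ dw ((v−w)·ω)₊ Y M(w) [φ(x,v′) + φ(x+εω,w′) − φ(x,v) − φ(x+εω,w)] = 0`,
`M = M_{1,u,θ}`, `v′ = v − ((v−w)·ω)ω`, `w′ = w + ((v−w)·ω)ω`, `x + εω = (Torus.geometry (Fin 3)).translate x (ε • ω)`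
— the shape of `½ ∫∫ f_s L^N_s φ_s` in `CollisionResidualVanishes` / `EquilibriumCollisionResidual` at
constant profiles `(ρ, u, θ) ≡ (1, u, θ)`.  [cite: CIP1994, §3.1] -/
theorem integral_localMaxwellian_mul_enskogTest_eq_zero {θ : ℝ} (hθ : 0 < θ) (u : V3) (ε lam Y : ℝ)
    {φ : T3 → V3 → ℝ} (hφ : Continuous (Function.uncurry φ)) {C : ℝ}
    (hC : ∀ x v, |φ x v| ≤ C * (1 + ‖v‖ ^ 2)) :
    ∫ x : T3, ∫ v : V3, localMaxwellian 1 θ u v *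
      (lam * ∫ ω : sphere (0 : V3) 1,
        (∫ w : V3, max ⟪v - w, (ω : V3)⟫_ℝ 0 * Y * localMaxwellian 1 θ u w *
          (φ x (v - ⟪v - w, (ω : V3)⟫_ℝ • (ω : V3)) +
            φ ((Torus.geometry (Fin 3)).translate x (ε • (ω : V3))) (w + ⟪v - w, (ω : V3)⟫_ℝ • (ω : V3)) -
            φ x v - φ ((Torus.geometry (Fin 3)).translate x (ε • (ω : V3))) w)) ∂sphereMeasure) = 0 := by
  haveI := isFiniteMeasure_sphereMeasure (E := V3)
  have hC0 : 0 ≤ C := by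
    have h := (abs_nonneg _).trans (hC 0 0)
    simpa using h
  -- notation
  set M : V3 → ℝ := localMaxwellian 1 θ u with hM
  set τ : T3 → sphere (0 : V3) 1 → T3 := fun x ω => (Torus.geometry (Fin 3)).translate x (ε • (ω : V3))
    with hτ
  obtain ⟨q, hq⟩ : ∃ q : T3 → sphere (0 : V3) 1 → ℝ, q = fun z ω =>
      ∫ p, M p.1 * M p.2 * hardSphereKernel p ω * (φ z p.1 - φ z p.2) ∂((volume : Measure V3).prod volume) :=
    ⟨_, rfl⟩
  set m₃ : ℝ := ∫ v, (1 + ‖v‖) ^ 3 * M v with hm₃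
  -- continuity facts
  have hMc : Continuous M := continuous_localMaxwellian 1 θ u
  have hφz : ∀ z : T3, Continuous (φ z) := fun z => hφ.comp (Continuous.prodMk_right z)
  have hτc : Continuous (Function.uncurry τ) := continuous_torus_translate_sphere ε
  have hm₃i : Integrable (fun v : V3 => (1 + ‖v‖) ^ 3 * M v) :=
    integrable_one_add_norm_pow_mul_localMaxwellian hθ u 3
  ----------------------------------------------------------------
  -- Step 1: the two inner velocity integrals, for fixed `x` and `ω`.
  ----------------------------------------------------------------
  have step1 : ∀ (x : T3) (ω : sphere (0 : V3) 1),
      ∫ v : V3, M v * ∫ w : V3, max ⟪v - w, (ω : V3)⟫_ℝ 0 * Y * M w *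
          (φ x (v - ⟪v - w, (ω : V3)⟫_ℝ • (ω : V3)) + φ (τ x ω) (w + ⟪v - w, (ω : V3)⟫_ℝ • (ω : V3)) -
            φ x v - φ (τ x ω) w) = Y * (q (τ x ω) ω - q x ω) := by
    intro x ω
    have hB := integral_localMaxwellian_kernel_bracket hθ u ω (hφz x) (hφz (τ x ω)) (hC x) (hC (τ x ω))
    set F : V3 × V3 → ℝ := fun p => Y * (M p.1 * M p.2 * hardSphereKernel p ω *
      (φ x (collide ω p).1 + φ (τ x ω) (collide ω p).2 - φ x p.1 - φ (τ x ω) p.2)) with hF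
    have hFi : Integrable F ((volume : Measure V3).prod volume) := by
      obtain ⟨hA1, -, hA3, -⟩ := integrable_localMaxwellian_kernel_quad hθ u ω (hφz x) (hC x)
      obtain ⟨-, hB2, -, hB4⟩ := integrable_localMaxwellian_kernel_quad hθ u ω (hφz (τ x ω)) (hC (τ x ω))
      have h := ((hA3.add hB4).sub hA1).sub hB2
      refine (h.const_mul Y).congr (Eventually.of_forall fun p => ?_)
      simp only [hF, Pi.add_apply, Pi.sub_apply]
      ring
    have hrow : ∀ v : V3, M v * ∫ w : V3, max ⟪v - w, (ω : V3)⟫_ℝ 0 * Y * M w *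
        (φ x (v - ⟪v - w, (ω : V3)⟫_ℝ • (ω : V3)) + φ (τ x ω) (w + ⟪v - w, (ω : V3)⟫_ℝ • (ω : V3)) -
          φ x v - φ (τ x ω) w) = ∫ w : V3, F (v, w) := by
      intro v
      rw [← integral_const_mul]
      refine integral_congr_ae (Eventually.of_forall fun w => ?_)
      simp only [hF, hardSphereKernel, collide]
      ring
    calc ∫ v : V3, M v * ∫ w : V3, max ⟪v - w, (ω : V3)⟫_ℝ 0 * Y * M w *
          (φ x (v - ⟪v - w, (ω : V3)⟫_ℝ • (ω : V3)) + φ (τ x ω) (w + ⟪v - w, (ω : V3)⟫_ℝ • (ω : V3)) -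
            φ x v - φ (τ x ω) w)
        = ∫ v : V3, ∫ w : V3, F (v, w) := integral_congr_ae (Eventually.of_forall hrow)
      _ = ∫ p, F p ∂((volume : Measure V3).prod volume) := (integral_prod F hFi).symm
      _ = Y * (q (τ x ω) ω - q x ω) := by
          rw [hF, integral_const_mul, hB]
          simp only [hq, hM]
  ----------------------------------------------------------------
  -- Step 2: Fubini `v ↔ ω` for fixed `x`.
  ----------------------------------------------------------------
  have step2 : ∀ x : T3,
      ∫ v : V3, M v * (lam * ∫ ω : sphere (0 : V3) 1, (∫ w : V3, max ⟪v - w, (ω : V3)⟫_ℝ 0 * Y * M w *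
          (φ x (v - ⟪v - w, (ω : V3)⟫_ℝ • (ω : V3)) + φ (τ x ω) (w + ⟪v - w, (ω : V3)⟫_ℝ • (ω : V3)) -
            φ x v - φ (τ x ω) w)) ∂sphereMeasure) =
        lam * Y * ∫ ω : sphere (0 : V3) 1, (q (τ x ω) ω - q x ω) ∂sphereMeasure := by
    intro x
    -- the joint integrand `H ((v, ω), w)` and the inner integral `I (v, ω) = ∫ H ((v, ω), w) dw`
    set H : (V3 × sphere (0 : V3) 1) × V3 → ℝ := fun r =>
      max ⟪r.1.1 - r.2, (r.1.2 : V3)⟫_ℝ 0 * Y * M r.2 *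
        (Function.uncurry φ (x, r.1.1 - ⟪r.1.1 - r.2, (r.1.2 : V3)⟫_ℝ • (r.1.2 : V3)) +
          Function.uncurry φ (Function.uncurry τ (x, r.1.2), r.2 + ⟪r.1.1 - r.2, (r.1.2 : V3)⟫_ℝ • (r.1.2 : V3)) -
          Function.uncurry φ (x, r.1.1) - Function.uncurry φ (Function.uncurry τ (x, r.1.2), r.2)) with hH
    have hHc : Continuous H := by
      simp only [hH]
      fun_prop
    set I : V3 × sphere (0 : V3) 1 → ℝ := fun s => ∫ w, H (s, w) with hI
    have hIm : StronglyMeasurable I := hHc.stronglyMeasurable.integral_prod_right'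
    have hIeq : ∀ (v : V3) (ω : sphere (0 : V3) 1), I (v, ω) = ∫ w : V3, max ⟪v - w, (ω : V3)⟫_ℝ 0 * Y * M w *
        (φ x (v - ⟪v - w, (ω : V3)⟫_ℝ • (ω : V3)) + φ (τ x ω) (w + ⟪v - w, (ω : V3)⟫_ℝ • (ω : V3)) -
          φ x v - φ (τ x ω) w) := fun v ω => rfl
    -- pointwise bound on the inner integral
    have hIbd : ∀ (v : V3) (ω : sphere (0 : V3) 1), |I (v, ω)| ≤ 4 * C * |Y| * m₃ * (1 + ‖v‖) ^ 3 := by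
      intro v ω
      have hg : Integrable (fun w : V3 => 4 * C * |Y| * (1 + ‖v‖) ^ 3 * ((1 + ‖w‖) ^ 3 * M w)) :=
        hm₃i.const_mul _
      have hle : ∀ w : V3, ‖H ((v, ω), w)‖ ≤ 4 * C * |Y| * (1 + ‖v‖) ^ 3 * ((1 + ‖w‖) ^ 3 * M w) := by
        intro w
        obtain ⟨hx1, -, hx3, -⟩ := quadGrowth_weights (hC x) ω (v, w)
        obtain ⟨-, hy2, -, hy4⟩ := quadGrowth_weights (hC (τ x ω)) ω (v, w)
        have hMw := localMaxwellian_nonneg zero_le_one hθ.le u w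
        have hK0 := UkaiLanford.hardSphereKernel_nonneg' (v, w) ω
        have hK := UkaiLanford.hardSphereKernel_le_weight (v, w) ω
        set X : ℝ := (1 + ‖v‖) * (1 + ‖w‖) with hX
        have hX0 : 0 ≤ X := by positivity
        have hBr : |φ x (collide ω (v, w)).1 + φ (τ x ω) (collide ω (v, w)).2 - φ x v - φ (τ x ω) w| ≤
            4 * C * X ^ 2 := by
          have e1 := abs_sub (φ x (collide ω (v, w)).1 + φ (τ x ω) (collide ω (v, w)).2 - φ x v) (φ (τ x ω) w)
          have e2 := abs_sub (φ x (collide ω (v, w)).1 + φ (τ x ω) (collide ω (v, w)).2) (φ x v)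
          have e3 := abs_add_le (φ x (collide ω (v, w)).1) (φ (τ x ω) (collide ω (v, w)).2)
          simp only at hx1 hy2 hx3 hy4
          linarith
        have hHvw : H ((v, ω), w) = hardSphereKernel (v, w) ω * Y * M w *
            (φ x (collide ω (v, w)).1 + φ (τ x ω) (collide ω (v, w)).2 - φ x v - φ (τ x ω) w) := by
          simp only [hH, hardSphereKernel, collide, Function.uncurry_apply_pair]
        rw [hHvw, Real.norm_eq_abs, abs_mul, abs_mul, abs_mul, abs_of_nonneg hK0, abs_of_nonneg hMw]
        calc hardSphereKernel (v, w) ω * |Y| * M w *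
              |φ x (collide ω (v, w)).1 + φ (τ x ω) (collide ω (v, w)).2 - φ x v - φ (τ x ω) w|
            ≤ X * |Y| * M w * (4 * C * X ^ 2) :=
              mul_le_mul (mul_le_mul_of_nonneg_right (mul_le_mul_of_nonneg_right hK (abs_nonneg _)) hMw)
                hBr (abs_nonneg _) (by positivity)
          _ = 4 * C * |Y| * (1 + ‖v‖) ^ 3 * ((1 + ‖w‖) ^ 3 * M w) := by simp only [hX]; ring
      have h := norm_integral_le_of_norm_le hg (Eventually.of_forall hle)
      rw [Real.norm_eq_abs, integral_const_mul] at h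
      simpa [hm₃, mul_comm, mul_left_comm, mul_assoc] using h
    -- integrability of `(v, ω) ↦ M v * I (v, ω)` on `ℝ³ × S²`
    have hGi : Integrable (Function.uncurry fun (v : V3) (ω : sphere (0 : V3) 1) => M v * I (v, ω))
        ((volume : Measure V3).prod sphereMeasure) := by
      have hbnd : Integrable (fun s : V3 × sphere (0 : V3) 1 =>
          4 * C * |Y| * m₃ * ((1 + ‖s.1‖) ^ 3 * M s.1)) ((volume : Measure V3).prod sphereMeasure) :=
        (hm₃i.comp_fst sphereMeasure).const_mul _
      refine hbnd.mono' ?_ (Eventually.of_forall fun s => ?_)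
      · exact ((hMc.comp continuous_fst).aestronglyMeasurable).mul hIm.aestronglyMeasurable
      · obtain ⟨v, ω⟩ := s
        have hMv := localMaxwellian_nonneg zero_le_one hθ.le u v
        simp only [Function.uncurry_apply_pair]
        rw [Real.norm_eq_abs, abs_mul, abs_of_nonneg hMv]
        calc M v * |I (v, ω)| ≤ M v * (4 * C * |Y| * m₃ * (1 + ‖v‖) ^ 3) :=
              mul_le_mul_of_nonneg_left (hIbd v ω) hMv
          _ = 4 * C * |Y| * m₃ * ((1 + ‖v‖) ^ 3 * M v) := by ring
    -- the computation
    have hswap := integral_integral_swap hGi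
    simp only at hswap
    calc ∫ v : V3, M v * (lam * ∫ ω : sphere (0 : V3) 1, (∫ w : V3, max ⟪v - w, (ω : V3)⟫_ℝ 0 * Y * M w *
            (φ x (v - ⟪v - w, (ω : V3)⟫_ℝ • (ω : V3)) + φ (τ x ω) (w + ⟪v - w, (ω : V3)⟫_ℝ • (ω : V3)) -
              φ x v - φ (τ x ω) w)) ∂sphereMeasure)
        = ∫ v : V3, lam * ∫ ω : sphere (0 : V3) 1, M v * I (v, ω) ∂sphereMeasure := by
          refine integral_congr_ae (Eventually.of_forall fun v => ?_)
          simp only [hIeq]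
          rw [integral_const_mul]
          ring
      _ = lam * ∫ ω : sphere (0 : V3) 1, (∫ v : V3, M v * I (v, ω)) ∂sphereMeasure := by
          rw [integral_const_mul, hswap]
      _ = lam * ∫ ω : sphere (0 : V3) 1, Y * (q (τ x ω) ω - q x ω) ∂sphereMeasure := by
          congr 1
          refine integral_congr_ae (Eventually.of_forall fun ω => ?_)
          simp only [hIeq]
          exact step1 x ω
      _ = lam * Y * ∫ ω : sphere (0 : V3) 1, (q (τ x ω) ω - q x ω) ∂sphereMeasure := by
          rw [integral_const_mul, mul_assoc]
  ----------------------------------------------------------------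
  -- Step 3: the `x`-integral — Fubini `x ↔ ω` and translation invariance on `𝕋³`.
  ----------------------------------------------------------------
  -- measurability and boundedness of `q`
  set Hq : (T3 × sphere (0 : V3) 1) × (V3 × V3) → ℝ := fun r =>
    M r.2.1 * M r.2.2 * max ⟪r.2.1 - r.2.2, (r.1.2 : V3)⟫_ℝ 0 *
      (Function.uncurry φ (r.1.1, r.2.1) - Function.uncurry φ (r.1.1, r.2.2)) with hHq
  have hHqc : Continuous Hq := by
    simp only [hHq]
    fun_prop
  have hqeq : Function.uncurry q = fun s : T3 × sphere (0 : V3) 1 =>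
      ∫ p, Hq (s, p) ∂((volume : Measure V3).prod volume) := by
    funext s
    obtain ⟨z, ω⟩ := s
    simp only [Function.uncurry_apply_pair, hq, hHq, hardSphereKernel]
  have hqm : StronglyMeasurable (Function.uncurry q) := by
    rw [hqeq]
    exact hHqc.stronglyMeasurable.integral_prod_right'
  have hqbd : ∀ (z : T3) (ω : sphere (0 : V3) 1), |q z ω| ≤ 2 * C * m₃ ^ 2 := by
    intro z ω
    rw [hq, hm₃]
    exact abs_integral_localMaxwellian_kernel_sub_le hθ u ω (hC z)
  -- the difference `D (x, ω) = q (x + εω, ω) − q (x, ω)` is bounded and measurable on `𝕋³ × S²`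
  have hD1 : StronglyMeasurable fun s : T3 × sphere (0 : V3) 1 => q (τ s.1 s.2) s.2 :=
    hqm.comp_measurable (hτc.measurable.prodMk measurable_snd)
  have hD2 : StronglyMeasurable fun s : T3 × sphere (0 : V3) 1 => q s.1 s.2 := hqm
  have hDi : Integrable (Function.uncurry fun (x : T3) (ω : sphere (0 : V3) 1) => q (τ x ω) ω - q x ω)
      ((volume : Measure T3).prod sphereMeasure) := by
    refine (integrable_const (2 * C * m₃ ^ 2 + 2 * C * m₃ ^ 2)).mono' (hD1.sub hD2).aestronglyMeasurable
      (Eventually.of_forall fun s => ?_)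
    rw [Real.norm_eq_abs]
    exact (abs_sub _ _).trans (add_le_add (hqbd _ _) (hqbd _ _))
  -- for each `ω` the `x`-integral of the difference vanishes (translation invariance of Haar measure)
  have hx0 : ∀ ω : sphere (0 : V3) 1, ∫ x : T3, (q (τ x ω) ω - q x ω) = 0 := by
    intro ω
    have hq1m : StronglyMeasurable fun x : T3 => q x ω := by
      have h := (hqm.comp_measurable (measurable_id.prodMk (measurable_const (a := ω))) :)
      exact h
    have hq1 : Integrable (fun x : T3 => q x ω) := by
      refine (integrable_const (2 * C * m₃ ^ 2)).mono' hq1m.aestronglyMeasurable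
        (Eventually.of_forall fun x => ?_)
      rw [Real.norm_eq_abs]
      exact hqbd x ω
    have hq2 : Integrable (fun x : T3 => q (τ x ω) ω) :=
      hq1.comp_add_right (Literature.Analysis.FunctionSpaces.Torus.proj (ε • (ω : V3)))
    rw [integral_sub hq2 hq1, sub_eq_zero]
    exact integral_add_right_eq_self (μ := (volume : Measure T3)) (fun x => q x ω)
      (Literature.Analysis.FunctionSpaces.Torus.proj (ε • (ω : V3)))
  -- assembly
  have hswap := integral_integral_swap hDi
  simp only at hswap
  calc ∫ x : T3, ∫ v : V3, M v * (lam * ∫ ω : sphere (0 : V3) 1,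
          (∫ w : V3, max ⟪v - w, (ω : V3)⟫_ℝ 0 * Y * M w *
            (φ x (v - ⟪v - w, (ω : V3)⟫_ℝ • (ω : V3)) +
              φ ((Torus.geometry (Fin 3)).translate x (ε • (ω : V3))) (w + ⟪v - w, (ω : V3)⟫_ℝ • (ω : V3)) -
              φ x v - φ ((Torus.geometry (Fin 3)).translate x (ε • (ω : V3))) w)) ∂sphereMeasure)
      = ∫ x : T3, lam * Y * ∫ ω : sphere (0 : V3) 1, (q (τ x ω) ω - q x ω) ∂sphereMeasure :=
        integral_congr_ae (Eventually.of_forall step2)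
    _ = lam * Y * ∫ x : T3, ∫ ω : sphere (0 : V3) 1, (q (τ x ω) ω - q x ω) ∂sphereMeasure :=
        integral_const_mul _ _
    _ = lam * Y * ∫ ω : sphere (0 : V3) 1, (∫ x : T3, (q (τ x ω) ω - q x ω)) ∂sphereMeasure := by
        rw [hswap]
    _ = 0 := by simp [hx0]

/-- Quadratic velocity growth and continuity of the route's admissible test functions
`φ(x, v) = α(x) + β(x)·v + γ(x)|v|²/2 + λ⁻¹ κ(x, v)` at a frozen time: if `‖(α, β, γ)(x)‖ ≤ C` and
`|κ(x, v)| ≤ C (1 + ‖v‖²)` then `|φ(x, v)| ≤ (3C + |λ⁻¹| C)(1 + ‖v‖²)`. [folklore] -/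
theorem admissible_frozen_quadGrowth {cc : T3 → ℝ × V3 × ℝ} {κκ : T3 → V3 → ℝ} (laminv : ℝ) {C : ℝ}
    (hcc : ∀ x, ‖cc x‖ ≤ C) (hκκ : ∀ x v, |κκ x v| ≤ C * (1 + ‖v‖ ^ 2)) (x : T3) (v : V3) :
    |(cc x).1 + ⟪(cc x).2.1, v⟫_ℝ + (cc x).2.2 * ‖v‖ ^ 2 / 2 + laminv * κκ x v| ≤
      (3 * C + |laminv| * C) * (1 + ‖v‖ ^ 2) := by
  have hC : 0 ≤ C := (norm_nonneg _).trans (hcc x)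
  have h1 : |(cc x).1| ≤ C := by
    have := norm_fst_le (cc x)
    rw [Real.norm_eq_abs] at this
    exact this.trans (hcc x)
  have h2 : ‖(cc x).2.1‖ ≤ C := ((norm_fst_le (cc x).2).trans (norm_snd_le (cc x))).trans (hcc x)
  have h3 : |(cc x).2.2| ≤ C := by
    have := (norm_snd_le (cc x).2).trans (norm_snd_le (cc x))
    rw [Real.norm_eq_abs] at this
    exact this.trans (hcc x)
  have hv : ‖v‖ ≤ 1 + ‖v‖ ^ 2 := by nlinarith [norm_nonneg v, sq_nonneg (‖v‖ - 1)]
  have hin : |⟪(cc x).2.1, v⟫_ℝ| ≤ C * (1 + ‖v‖ ^ 2) :=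
    (abs_real_inner_le_norm _ _).trans (mul_le_mul h2 hv (norm_nonneg _) hC)
  have hsq : |(cc x).2.2 * ‖v‖ ^ 2 / 2| ≤ C * (1 + ‖v‖ ^ 2) := by
    rw [abs_div, abs_mul, abs_of_nonneg (sq_nonneg ‖v‖), abs_two]
    have : |(cc x).2.2| * ‖v‖ ^ 2 ≤ C * (1 + ‖v‖ ^ 2) :=
      mul_le_mul h3 (by nlinarith) (sq_nonneg _) hC
    linarith [mul_nonneg (abs_nonneg (cc x).2.2) (sq_nonneg ‖v‖)]
  have hκ' : |laminv * κκ x v| ≤ |laminv| * C * (1 + ‖v‖ ^ 2) := by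
    rw [abs_mul, mul_assoc]
    exact mul_le_mul_of_nonneg_left (hκκ x v) (abs_nonneg _)
  have h1' : |(cc x).1| ≤ C * (1 + ‖v‖ ^ 2) := h1.trans (le_mul_of_one_le_right hC (by nlinarith [sq_nonneg ‖v‖]))
  calc |(cc x).1 + ⟪(cc x).2.1, v⟫_ℝ + (cc x).2.2 * ‖v‖ ^ 2 / 2 + laminv * κκ x v|
      ≤ |(cc x).1| + |⟪(cc x).2.1, v⟫_ℝ| + |(cc x).2.2 * ‖v‖ ^ 2 / 2| + |laminv * κκ x v| := by
        refine (abs_add_le _ _).trans (add_le_add ((abs_add_le _ _).trans (add_le_add (abs_add_le _ _) le_rfl)) le_rfl)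
    _ ≤ C * (1 + ‖v‖ ^ 2) + C * (1 + ‖v‖ ^ 2) + C * (1 + ‖v‖ ^ 2) + |laminv| * C * (1 + ‖v‖ ^ 2) :=
        add_le_add (add_le_add (add_le_add h1' hin) hsq) hκ'
    _ = (3 * C + |laminv| * C) * (1 + ‖v‖ ^ 2) := by ring

/-- **The centring term of `EquilibriumCollisionResidual` vanishes identically.** In the vocabulary of
the route decl `EnskogAdjointDuality.EquilibriumCollisionResidual` (its `let`-chain verbatim, constant
profiles `ρ ≡ 1`, `u ≡ uu`, `θ ≡ th`): for every admissible family `(c^N, κ^N)`, every `N` and every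
frozen time `s`, `∫_{𝕋³} ∫ f_s(x, v) (L^N_s φ^N_s)(x, v) dv dx = 0`.  Hence at global equilibrium
`𝓡_N[φ^N] = C_N[φ^N] − ∫₀ᵗ ⟨μ^N_s, L^N_s φ^N_s⟩ ds` exactly: no deterministic constant can be produced
by the `½ ∫∫ f Lφ` term (kill criterion (a) of the route cannot fire at equilibrium).
[cite: CIP1994, §3.1] -/
theorem equilibrium_centringTerm_eq_zero (σ th : ℝ) (hth : 0 < th) (uu : EuclideanSpace ℝ (Fin 3))
    (c : ℕ → ℝ → UnitAddTorus (Fin 3) → ℝ × EuclideanSpace ℝ (Fin 3) × ℝ)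
    (κ : ℕ → ℝ → UnitAddTorus (Fin 3) → EuclideanSpace ℝ (Fin 3) → ℝ)
    (hc : ∀ N, Continuous (Function.uncurry (c N)))
    (hκ : ∀ N, Continuous (fun p : ℝ × UnitAddTorus (Fin 3) × EuclideanSpace ℝ (Fin 3) => κ N p.1 p.2.1 p.2.2))
    (hB : ∃ C : ℝ, ∀ N s x x' v v', ‖c N s x‖ ≤ C ∧ dist (c N s x) (c N s x') ≤ C * dist x x' ∧
      |κ N s x v| ≤ C * (1 + ‖v‖ ^ 2) ∧
      |κ N s x v - κ N s x' v'| ≤ C * (1 + ‖v‖ ^ 2 + ‖v'‖ ^ 2) * (dist x x' + ‖v - v'‖))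
    (N : ℕ) (s : ℝ) :
    let ρ := fun (_ : ℝ) (_ : UnitAddTorus (Fin 3)) => (1 : ℝ);
    let u := fun (_ : ℝ) (_ : UnitAddTorus (Fin 3)) => uu;
    let θ := fun (_ : ℝ) (_ : UnitAddTorus (Fin 3)) => th;
    let G := Literature.Analysis.FluidPDE.Torus.geometry (Fin 3);
    let ε := fun N : ℕ => Literature.MathematicalPhysics.KineticTheory.hsDiameter σ N;
    let lam := fun N : ℕ => (N : ℝ) * ε N ^ 2;
    let f := fun (s : ℝ) (x : UnitAddTorus (Fin 3)) (v : EuclideanSpace ℝ (Fin 3)) =>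
      ρ s x * Literature.Analysis.FluidPDE.localMaxwellian 1 (θ s x) (u s x) v;
    let Y := fun η : ℝ => 3 / (2 * Real.pi) * deriv Literature.MathematicalPhysics.KineticTheory.hsExcessFreeEnergy η;
    let φ := fun (N : ℕ) (s : ℝ) (x : UnitAddTorus (Fin 3)) (v : EuclideanSpace ℝ (Fin 3)) =>
      (c N s x).1 + inner ℝ (c N s x).2.1 v + (c N s x).2.2 * ‖v‖ ^ 2 / 2 + (lam N)⁻¹ * κ N s x v;
    let L := fun (N : ℕ) (s : ℝ) (x : UnitAddTorus (Fin 3)) (v : EuclideanSpace ℝ (Fin 3)) =>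
      lam N * ∫ ω : Metric.sphere (0 : EuclideanSpace ℝ (Fin 3)) 1,
        (let y := G.translate x (ε N • (ω : EuclideanSpace ℝ (Fin 3)));
        ∫ w : EuclideanSpace ℝ (Fin 3), max (inner ℝ (v - w) ω) 0 *
          Y (σ ^ 3 * ρ s (G.translate x ((ε N / 2) • (ω : EuclideanSpace ℝ (Fin 3))))) * f s y w *
          (φ N s x (v - inner ℝ (v - w) ω • (ω : EuclideanSpace ℝ (Fin 3))) +
            φ N s y (w + inner ℝ (v - w) ω • (ω : EuclideanSpace ℝ (Fin 3))) - φ N s x v - φ N s y w))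
        ∂Literature.MathematicalPhysics.KineticTheory.sphereMeasure;
    ∫ x : UnitAddTorus (Fin 3), ∫ v : EuclideanSpace ℝ (Fin 3), f s x v * L N s x v = 0 := by
  intro ρ u θ G ε lam f Y φ L
  obtain ⟨C, hCB⟩ := hB
  -- the frozen test function and its regularity
  have hφc : Continuous (Function.uncurry (φ N s)) := by
    have hcx : Continuous fun x : UnitAddTorus (Fin 3) => c N s x :=
      (hc N).comp (Continuous.prodMk_right s)
    have hκx : Continuous fun p : UnitAddTorus (Fin 3) × EuclideanSpace ℝ (Fin 3) => κ N s p.1 p.2 :=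
      (hκ N).comp (continuous_const.prodMk continuous_id)
    show Continuous fun p : UnitAddTorus (Fin 3) × EuclideanSpace ℝ (Fin 3) =>
      (c N s p.1).1 + inner ℝ (c N s p.1).2.1 p.2 + (c N s p.1).2.2 * ‖p.2‖ ^ 2 / 2 + (lam N)⁻¹ * κ N s p.1 p.2
    have h1 : Continuous fun p : UnitAddTorus (Fin 3) × EuclideanSpace ℝ (Fin 3) => c N s p.1 :=
      hcx.comp continuous_fst
    fun_prop
  have hφb : ∀ x v, |φ N s x v| ≤ (3 * C + |(lam N)⁻¹| * C) * (1 + ‖v‖ ^ 2) := fun x v =>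
    admissible_frozen_quadGrowth (cc := c N s) (κκ := κ N s) (lam N)⁻¹ (fun x => (hCB N s x x 0 0).1)
      (fun x v => (hCB N s x x v v).2.2.1) x v
  have key := integral_localMaxwellian_mul_enskogTest_eq_zero hth uu (ε N) (lam N) (Y (σ ^ 3)) hφc hφb
  -- match the shapes: `ρ ≡ 1`, `θ ≡ th`, `u ≡ uu`
  have hf : ∀ (r : ℝ) (x : UnitAddTorus (Fin 3)) (v : EuclideanSpace ℝ (Fin 3)),
      f r x v = Literature.Analysis.FluidPDE.localMaxwellian 1 th uu v := fun r x v => one_mul _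
  have hY : ∀ (r : ℝ) (x : UnitAddTorus (Fin 3)), Y (σ ^ 3 * ρ r x) = Y (σ ^ 3) := fun r x => by
    show Y (σ ^ 3 * 1) = Y (σ ^ 3)
    rw [mul_one]
  simp only [hf, hY, L]
  exact key

end Torus

end Summit.AtomisticToContinuum.HydrodynamicLimit.Theorems.EnskogAdjointDuality

end
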